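import Literature.AlgebraicGeometry.VanGeemen1994.WeilTypeHodgeGroupSUCentre
import Literature.AlgebraicGeometry.Milne1999.CentraliserFixesDivisorClasses
import Literature.AlgebraicGeometry.Milne1999.LefschetzCentraliserRemark12
import Literature.AlgebraicGeometry.Deligne1982.HodgeGroupCommutantSpan
import Literature.AlgebraicGeometry.HodgeTheory.HodgeRiemannDegreeOneProofs
import Literature.AlgebraicGeometry.HodgeTheory.HardLefschetzNFoldHolds
import Literature.AlgebraicGeometry.HodgeTheory.WeilClassesFieldRationalSpan
import Literature.AlgebraicGeometry.ComplexMultiplication.EndAlgebraCommSubalgebraDegreeBound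
import Literature.NumberTheory.DiophantineGeometry.AVIsogenyTateFreeHomProofs
import Mathlib.LinearAlgebra.Eigenspace.Pi
import Mathlib.LinearAlgebra.Eigenspace.Triangularizable
import Mathlib.LinearAlgebra.Eigenspace.Minpoly
import Mathlib.LinearAlgebra.BilinearForm.Properties
import Mathlib.RingTheory.Finiteness.Nilpotent
import Mathlib.RingTheory.Localization.Integral
import HarnessLib

/-!
# The Hodge group of a complex abelian variety without factors of type IV is semisimple — discharge of the named fact `MoonenZarhin1999_semisimple_of_hasNoTypeIVFactor`

This file PROVES, on the carriers of the tree, the named fact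

* `HodgeTheory.MoonenZarhin1999_semisimple_of_hasNoTypeIVFactor :
    ∀ A : AbelianVariety ℂ, HasNoTypeIVFactor A → HasSemisimpleHodgeGroup A`

of `HodgeTheory/HodgeGroupProductSemisimpleCMFactor.lean` (there vendored as `def … : Prop` with
`[cite: MoonenZarhin1999LowDim, §1]`), as the theorem
`MoonenZarhin1999_semisimple_of_hasNoTypeIVFactor_holds`. Recall the tree's renderings:
`HasNoTypeIVFactor A` — every element of the centre of `End⁰(A) = ℚ ⊗ End A` is killed by a non-zero
rational polynomial all of whose complex roots are real (the centre is a product of totally real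
fields: no simple factor of Albert type IV); `HasSemisimpleHodgeGroup A` — the centre of the
(Tannaka-free) Hodge group `Hg(A)(ℂ) = hodgeGroup A.dim A.X ≤ ∏ₖ GL(Hᵏ(A(ℂ); ℂ))` is finite.

## Sources

* Moonen–Zarhin, *Hodge classes on abelian varieties of low dimension* (Math. Ann. 315, 1999), §1:
  "Viewing `D = End⁰(X)` as a subalgebra of `End_ℚ(V)` we have `D = End_ℚ(V)^{Hg(X)}`. If `φ` is the
  Riemann form associated to a polarization of `X` then `Hg(X) ⊂ Sp_D(V, φ)`, the centralizer of `D` in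
  the symplectic group. … If `X` has no factors of Type 4 then `Hg(X)` is semi-simple."
  [cite: MoonenZarhin1999LowDim, §1]
* Moonen–Zarhin, *Weil classes on abelian varieties* (Crelle 496, 1998), §1, second Remark after the
  Criterion: "If `X` has no factors of type 4 then the Hodge group `Hdg(X)` is semi-simple (see [Chi])";
  §1 Lemma (1): "The center of `G_div(X)` is the group `U_{K_B}`, `U_{K_B}(R) = {a ∈ (K_B ⊗ R)^* |
  a a† = 1}` … For `X` of type 4 with `d ≥ 2` or `m ≥ 2` this is a connected torus; in all other cases
  it is finite"; and "the center `Z(Hdg)` of the Hodge group is contained in the torus `U_E`".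
  [cite: MoonenZarhin1998WeilClasses, §1 (second Remark after the Criterion; Lemma (1); "Z(Hdg) ⊂ U_E")]
* Deligne, *Hodge cycles on abelian varieties*, I Prop. 3.4 (the commutant of the Hodge group in
  `End(H)` is the algebra of Hodge endomorphisms) — in the tree the THEOREMS
  `Deligne1982.mem_span_complexBetti_map_of_commute_hodgeGroup`, `Deligne1982.mem_typePiece_of_commute_hodgeGroup`.
  [cite: Deligne1982HodgeCycles, I §3, Prop. 3.4 and its proof]
* Deligne–Milne, *Tannakian categories*, II Thm. 6.20 (Riemann: weight-one Hodge morphisms of `H¹` come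
  from `End⁰`) — the tree's `deligneMilne1982_Thm_6_20_full_holds`. [cite: DeligneMilne1982Tannakian, II Thm. 6.20 (Riemann), p. 212]
* Lange–Birkenhake, *Complex Abelian Varieties*, Ch. 5 §1 (the Rosati involution is the adjoint for the
  Riemann form and is positive) and Ch. 1 §2 (the rational representation is faithful).
  [cite: LangeBirkenhake1992, §5.1 and §1.2]

## The printed argument and its carrier form

Printed (Moonen–Zarhin, following Mumford/Tankeev/Chi): `Hg ⊂ Sp_D(V, φ)`, so the centre `Z(Hg)`
commutes with `Hg` — hence lies in `D ⊗` (Deligne's commutant theorem) — and with `D`, hence lies in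
the centre `E = Z(D)`; being inside `Sp(V, φ)` it satisfies `a a† = 1` for the Rosati involution `†`,
i.e. `Z(Hg) ⊂ U_E`. With no factor of type IV, `E` is a product of totally real fields, `†` (a positive
involution) is the identity on `E`, so `U_E = {a ∈ E ⊗ R | a² = 1}` is finite.

Carrier form proved here (everything on `V = H¹(A(ℂ); ℂ)`, where `Hg(A)(ℂ) ≅ Hg(A)(ℂ)|_{H¹}` by
`VanGeemen1994.finite_center_hodgeGroup_of_hodgeGroupOne`):

* Part 0 (`HodgeGroupSemisimple.*`, pure linear algebra over `ℂ`): adjoints for a non-degenerate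
  alternating form `B`; the positivity lemma `eq_of_isAdj_of_comm` — if `Y`, `Y'` are `B`-adjoint,
  commute, are real for an anti-linear involution `cj`, preserve a splitting `V = H¹⁰ ⊕ H⁰¹` with
  `cj H⁰¹ ⊂ H¹⁰` and `B(x, cj x) ≠ 0` on pure non-zero `x`, and `Y` has real eigenvalues, then `Y' = Y`
  (the nilpotent part of `Y - Y'` is killed by positivity, eigenvalue by eigenvalue); and
  `finite_of_comm_of_mul_self_eq_one` — a commutative subgroup of `GL(V)` of exponent `2` is finite
  (simultaneous generalised-eigenspace decomposition of a commuting family, `Module.End.iSup_iInf_maxGenEigenspace_eq_top_of_iSup_maxGenEigenspace_eq_top_of_commute`).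
* Part 1 (carriers): a polarization class `h = e^*a` gives `B = coord ∘ Q_h` on `H¹` — alternating,
  non-degenerate (hard Lefschetz, `Milne1999.eq_zero_of_forall_polarizationPairingOne_eq_zero_of_hasHardLefschetzProperty`),
  real, `Hg`-invariant (`Milne1999.hodgeGroupOne_le_unitaryCentralizerGroup_of_isRationalClass`) and
  Hodge–Riemann positive on `H^{1,0}` (`hodgeRiemann_degreeOne_of_isOfHodgeType`); Galois descent with
  the centraliser condition (`mem_span_pullbackOne_of_commute`: an endomorphism commuting with `Hg` and
  with all `φ^*` is a `ℂ`-combination of pull-backs `u^*` lying in Milne's centraliser `C(A) ⊗ ℂ`);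
  such `u` are central in `End(A)`, so under `HasNoTypeIVFactor` the eigenvalues of `u^*` are real
  (`conj_eigenvalue_pullbackOne`, clearing denominators with `IsLocalization.integerNormalization` and
  transporting the integral relation by `aeval_hom_complexBetti_map_one_eq_zero`); hence `u^*` is
  `B`-self-adjoint (`isAdj_self_pullbackOne`: its adjoint commutes with `Hg`, so lies in `End⁰(A) ⊗ ℂ`
  and commutes with `u^*`; Part 0 applies).
* Part 2: a central `z ∈ Hg(A)(ℂ)|_{H¹}` is therefore `B`-symmetric and `B`-orthogonal, so `z² = 1`
  (`mul_self_eq_one_of_mem_center`), and the centre is finite (`finite_center_hodgeGroupOne`).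
* Part 3: the named fact (`dim A = 0`: `H¹ = 0`).

## What is NOT here

No algebraic-group structure on `Hg` (the tree's Hodge group is the Tannaka-free subgroup of
`∏ₖ GL(Hᵏ)`), no Albert classification, no structure theory of `End⁰(A)`: the hypothesis is consumed
exactly as typed (`HasNoTypeIVFactor`: real minimal polynomials on the centre). No new definition of
mathematical content, no `def` at all, and NO new named fact (the linear-algebra helpers of Part 0
are private theorems). Net debt: `−1` (`MoonenZarhin1999_semisimple_of_hasNoTypeIVFactor` discharged).
-/

noncomputable section

namespace Literature.AlgebraicGeometry.HodgeTheory

namespace HodgeGroupSemisimple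

open Module

variable {V : Type*} [AddCommGroup V] [Module ℂ V] [FiniteDimensional ℂ V]

/-! ### 0a. Eigenvectors inside an invariant subspace -/

/-- An endomorphism preserving a non-zero subspace of a finite-dimensional complex vector space has an
eigenvector in it. [folklore] -/
private theorem exists_eigenvector_of_mapsTo {W : Submodule ℂ V} (hW : W ≠ ⊥) {T : Module.End ℂ V}
    (hT : Set.MapsTo T W W) : ∃ c : ℂ, ∃ v ∈ W, v ≠ 0 ∧ T v = c • v := by
  haveI : Nontrivial W := Submodule.nontrivial_iff_ne_bot.2 hW
  obtain ⟨c, hc⟩ := Module.End.exists_eigenvalue (T.restrict hT)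
  obtain ⟨⟨v, hv⟩, hv'⟩ := hc.exists_hasEigenvector
  refine ⟨c, v, hv, fun h0 ↦ hv'.2 (Subtype.ext h0), ?_⟩
  have h := congrArg Subtype.val hv'.apply_eq_smul
  simpa [LinearMap.restrict_apply] using h

/-! ### 0b. Adjoints for an alternating non-degenerate bilinear form -/

section Adjoint

variable {B : LinearMap.BilinForm ℂ V} (hBalt : ∀ x y, B y x = -B x y)

/-- Every endomorphism has an adjoint for a non-degenerate form. [folklore] -/
private theorem exists_isAdj (hBnd : B.Nondegenerate) (T : Module.End ℂ V) :
    ∃ T' : Module.End ℂ V, ∀ x y, B (T' x) y = B x (T y) :=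
  ⟨B.leftAdjointOfNondegenerate hBnd T, fun x y ↦ B.isAdjointPairLeftAdjointOfNondegenerate hBnd T x y⟩

omit [FiniteDimensional ℂ V] in
include hBalt in
/-- For an alternating form the adjoint relation can be read on either side. [folklore] -/
private theorem isAdj_apply_right {T T' : Module.End ℂ V} (h : ∀ x y, B (T' x) y = B x (T y)) (x y : V) :
    B x (T' y) = B (T x) y := by
  rw [hBalt (T' y) x, h, hBalt, neg_neg]

omit [FiniteDimensional ℂ V] in
/-- Left separation: `B x y = B x' y` for all `y` forces `x = x'`. [folklore] -/
private theorem eq_of_forall_left (hBnd : B.Nondegenerate) {x x' : V} (h : ∀ y, B x y = B x' y) : x = x' := by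
  have h0 : x - x' = 0 := hBnd.1 _ fun y ↦ by rw [map_sub, LinearMap.sub_apply, h, sub_self]
  exact sub_eq_zero.1 h0

omit [FiniteDimensional ℂ V] in
/-- Right separation. [folklore] -/
private theorem eq_of_forall_right (hBnd : B.Nondegenerate) {y y' : V} (h : ∀ x, B x y = B x y') : y = y' := by
  have h0 : y - y' = 0 := hBnd.2 _ fun x ↦ by rw [map_sub, h, sub_self]
  exact sub_eq_zero.1 h0

omit [FiniteDimensional ℂ V] in
/-- **If `T` commutes with `S` then `T'` commutes with `S'`.** [folklore] -/
private theorem isAdj_mul_comm_of_mul_comm (hBnd : B.Nondegenerate) {T T' S S' : Module.End ℂ V}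
    (hT : ∀ x y, B (T' x) y = B x (T y)) (hS : ∀ x y, B (S' x) y = B x (S y))
    (h : T * S = S * T) : T' * S' = S' * T' := by
  refine LinearMap.ext fun x ↦ eq_of_forall_left hBnd fun y ↦ ?_
  rw [Module.End.mul_apply, Module.End.mul_apply, hT, hS, hS, hT, ← Module.End.mul_apply,
    ← Module.End.mul_apply, h]

omit [FiniteDimensional ℂ V] in
/-- An isometry `u` of `B` is the adjoint of `u⁻¹`. [folklore] -/
private theorem isAdj_symm_of_isometry {u : V ≃ₗ[ℂ] V} (hu : ∀ x y, B (u x) (u y) = B x y) :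
    ∀ x y, B ((u : Module.End ℂ V) x) y = B x ((u.symm : Module.End ℂ V) y) := fun x y ↦ by
  show B (u x) y = B x (u.symm y)
  rw [← hu x (u.symm y), LinearEquiv.apply_symm_apply]

/-- **An eigenvalue of the adjoint is an eigenvalue.** [folklore] -/
private theorem isAdj_exists_eigenvector (hBnd : B.Nondegenerate) {T T' : Module.End ℂ V}
    (h : ∀ x y, B (T' x) y = B x (T y)) {μ : ℂ} {v : V} (hv : v ≠ 0) (hμ : T' v = μ • v) :
    ∃ w : V, w ≠ 0 ∧ T w = μ • w := by
  by_contra hne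
  have hinj : Function.Injective (T - μ • (1 : Module.End ℂ V)) := by
    rw [← LinearMap.ker_eq_bot, Submodule.eq_bot_iff]
    intro w hw
    rw [LinearMap.mem_ker, LinearMap.sub_apply, LinearMap.smul_apply, Module.End.one_apply,
      sub_eq_zero] at hw
    by_contra hw0
    exact hne ⟨w, hw0, hw⟩
  have hsurj : Function.Surjective (T - μ • (1 : Module.End ℂ V)) :=
    LinearMap.surjective_of_injective hinj
  apply hv
  refine hBnd.1 v fun y ↦ ?_
  obtain ⟨x, rfl⟩ := hsurj y
  have e1 : B v (T x) = μ * B v x := by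
    rw [← h, hμ, map_smul, LinearMap.smul_apply, smul_eq_mul]
  rw [LinearMap.sub_apply, LinearMap.smul_apply, Module.End.one_apply, map_sub, e1,
    LinearMap.map_smul, smul_eq_mul, sub_self]

end Adjoint

/-! ### 0c. Real structure, Hodge pieces of weight one, positivity -/

section Positivity

variable {B : LinearMap.BilinForm ℂ V} {cj : V → V} {H10 H01 : Submodule ℂ V}
variable (hBalt : ∀ x y, B y x = -B x y)
  (cj_add : ∀ x y, cj (x + y) = cj x + cj y) (cj_smul : ∀ (a : ℂ) x, cj (a • x) = starRingEnd ℂ a • cj x)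
  (cj_cj : ∀ x, cj (cj x) = x)
  (hcompl : IsCompl H10 H01) (hcj01 : ∀ x ∈ H01, cj x ∈ H10)
  (hpos : ∀ x ∈ H10, x ≠ 0 → B x (cj x) ≠ 0)

/-- An involution is injective. [folklore] -/
private theorem cj_injective {W : Type*} {c : W → W} (hc : ∀ x, c (c x) = x) : Function.Injective c :=
  fun x y h ↦ by rw [← hc x, h, hc]

/-- An additive self-map fixes `0`. [folklore] -/
private theorem cj_zero {W : Type*} [AddGroup W] {c : W → W} (hc : ∀ x y, c (x + y) = c x + c y) : c 0 = 0 := by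
  have h := hc 0 0
  rw [add_zero] at h
  exact left_eq_add.1 h

omit [FiniteDimensional ℂ V] in
include cj_add cj_smul in
/-- An additive anti-linear map is compatible with subtraction. [folklore] -/
private theorem cj_sub (a b : V) : cj (a - b) = cj a - cj b := by
  rw [sub_eq_add_neg, cj_add, ← neg_one_smul ℂ b, cj_smul, map_neg, map_one, neg_one_smul,
    ← sub_eq_add_neg]

omit [FiniteDimensional ℂ V] in
include hBalt cj_cj hcj01 hpos cj_add in
/-- Positivity on both pieces: `B x (cj x) ≠ 0` for `x ≠ 0` of pure type. [folklore] -/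
private theorem apply_cj_ne_zero_of_pure {x : V} (hx : x ∈ H10 ∨ x ∈ H01) (hx0 : x ≠ 0) : B x (cj x) ≠ 0 := by
  rcases hx with hx | hx
  · exact hpos x hx hx0
  · have h1 : cj x ≠ 0 := fun h ↦ hx0 (cj_injective cj_cj (by rw [h, cj_zero cj_add]))
    have h2 := hpos (cj x) (hcj01 x hx) h1
    rw [cj_cj] at h2
    rw [hBalt (cj x) x]
    exact neg_ne_zero.2 h2

omit [FiniteDimensional ℂ V] in
include hcompl in
/-- Every vector decomposes along `H10 ⊕ H01`. [folklore] -/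
private theorem exists_add_eq (x : V) : ∃ a ∈ H10, ∃ b ∈ H01, a + b = x := by
  have hx : x ∈ H10 ⊔ H01 := by rw [hcompl.sup_eq_top]; exact Submodule.mem_top
  obtain ⟨a, ha, b, hb, hab⟩ := Submodule.mem_sup.1 hx
  exact ⟨a, ha, b, hb, hab⟩

omit [FiniteDimensional ℂ V] in
include hcompl in
/-- Uniqueness of the decomposition along `H10 ⊕ H01`. [folklore] -/
private theorem eq_of_add_eq_add {a a' b b' : V} (ha : a ∈ H10) (ha' : a' ∈ H10) (hb : b ∈ H01) (hb' : b' ∈ H01)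
    (h : a + b = a' + b') : a = a' ∧ b = b' := by
  have h1 : a - a' = b' - b := by
    rw [sub_eq_iff_eq_add, sub_add_eq_add_sub, eq_sub_iff_add_eq, h, add_comm]
  have h2 : a - a' ∈ H10 ⊓ H01 :=
    ⟨Submodule.sub_mem _ ha ha', by rw [h1]; exact Submodule.sub_mem _ hb' hb⟩
  rw [hcompl.inf_eq_bot, Submodule.mem_bot, sub_eq_zero] at h2
  refine ⟨h2, ?_⟩
  rw [h2] at h
  exact add_left_cancel h

omit [FiniteDimensional ℂ V] in
include hBalt cj_cj hcj01 hpos cj_add hcompl in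
/-- **(L1, square-zero case)** A real, type-preserving, `ε`-symmetric endomorphism with `T² = 0`
vanishes: `B (T x) (cj (T x)) = ε B x (T² (cj x)) = 0` for `x` of pure type. [folklore] -/
private theorem eq_zero_of_sq_eq_zero {T : Module.End ℂ V} (hre : ∀ x, cj (T x) = T (cj x))
    (htp : (∀ x ∈ H10, T x ∈ H10) ∧ (∀ x ∈ H01, T x ∈ H01)) {ε : ℂ} (hε : ∀ x y, B (T x) y = ε * B x (T y)) (h2 : T * T = 0) : T = 0 := by
  have hpure : ∀ x, (x ∈ H10 ∨ x ∈ H01) → T x = 0 := by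
    intro x hx
    by_contra hTx
    have hTx' : T x ∈ H10 ∨ T x ∈ H01 := hx.imp (htp.1 x) (htp.2 x)
    apply apply_cj_ne_zero_of_pure hBalt cj_add cj_cj hcj01 hpos hTx' hTx
    have e : T (T (cj x)) = (T * T) (cj x) := rfl
    rw [hre, hε, e, h2, LinearMap.zero_apply, map_zero, mul_zero]
  refine LinearMap.ext fun x ↦ ?_
  obtain ⟨a, ha, b, hb, rfl⟩ := exists_add_eq hcompl x
  rw [map_add, hpure a (Or.inl ha), hpure b (Or.inr hb), add_zero, LinearMap.zero_apply]

omit [FiniteDimensional ℂ V] in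
include hBalt cj_cj hcj01 hpos cj_add hcompl in
/-- **(L1)** A real, type-preserving, `ε`-symmetric endomorphism with `T^(2^k) = 0` vanishes.
[folklore] -/
private theorem eq_zero_of_pow_two_pow_eq_zero :
    ∀ (k : ℕ) {T : Module.End ℂ V}, (∀ x, cj (T x) = T (cj x)) →
      ((∀ x ∈ H10, T x ∈ H10) ∧ (∀ x ∈ H01, T x ∈ H01)) → ∀ {ε : ℂ}, (∀ x y, B (T x) y = ε * B x (T y)) → T ^ (2 ^ k) = 0 → T = 0
  | 0, T, _, _, ε, _, h => by simpa using h
  | k + 1, T, hre, htp, ε, hε, h => by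
    have hre2 : ∀ x, cj ((T * T) x) = (T * T) (cj x) := fun x ↦ by
      rw [Module.End.mul_apply, Module.End.mul_apply, hre, hre]
    have htp2 : (∀ x ∈ H10, (T * T) x ∈ H10) ∧ (∀ x ∈ H01, (T * T) x ∈ H01) :=
      ⟨fun x hx ↦ htp.1 _ (htp.1 x hx), fun x hx ↦ htp.2 _ (htp.2 x hx)⟩
    have hε2 : ∀ x y, B ((T * T) x) y = (ε * ε) * B x ((T * T) y) := fun x y ↦ by
      rw [Module.End.mul_apply, Module.End.mul_apply, hε, hε, mul_assoc]
    have h' : (T * T) ^ (2 ^ k) = 0 := by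
      rw [← pow_two, ← pow_mul, ← pow_succ']
      exact h
    have h2 := eq_zero_of_pow_two_pow_eq_zero k hre2 htp2 hε2 h'
    exact eq_zero_of_sq_eq_zero hBalt cj_add cj_cj hcompl hcj01 hpos hre htp hε h2

omit [FiniteDimensional ℂ V] in
include hBalt cj_cj hcj01 hpos cj_add hcompl in
/-- **(L1)** A NILPOTENT real, type-preserving, `ε`-symmetric endomorphism vanishes. [folklore] -/
private theorem eq_zero_of_isNilpotent {T : Module.End ℂ V} (hre : ∀ x, cj (T x) = T (cj x))
    (htp : (∀ x ∈ H10, T x ∈ H10) ∧ (∀ x ∈ H01, T x ∈ H01)) {ε : ℂ} (hε : ∀ x y, B (T x) y = ε * B x (T y)) (hT : IsNilpotent T) : T = 0 := by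
  obtain ⟨m, hm⟩ := hT
  exact eq_zero_of_pow_two_pow_eq_zero hBalt cj_add cj_cj hcompl hcj01 hpos m hre htp hε
    (pow_eq_zero_of_le Nat.lt_two_pow_self.le hm)

/-- An endomorphism of a finite-dimensional complex vector space all of whose eigenvalues vanish is
nilpotent. [folklore] -/
private theorem isNilpotent_of_forall_eigenvalue_eq_zero {D : Module.End ℂ V}
    (hD : ∀ (δ : ℂ) (v : V), v ≠ 0 → D v = δ • v → δ = 0) : IsNilpotent D := by
  rw [Module.End.isNilpotent_iff_of_finite]
  intro m
  have hm : m ∈ ⨆ μ, D.maxGenEigenspace μ := by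
    rw [Module.End.iSup_maxGenEigenspace_eq_top]; exact Submodule.mem_top
  refine Submodule.iSup_induction (motive := fun m ↦ ∃ n : ℕ, (D ^ n) m = 0) _ hm ?_ ⟨0, by simp⟩ ?_
  · intro μ x hx
    by_cases hμ : μ = 0
    · subst hμ
      obtain ⟨k, hk⟩ := (Module.End.mem_maxGenEigenspace D 0 x).1 hx
      exact ⟨k, by simpa using hk⟩
    · have hbot : D.maxGenEigenspace μ = ⊥ := by
        by_contra hne
        have h1 : D.HasUnifEigenvalue μ ⊤ := hne
        obtain ⟨v, hv⟩ := Module.End.HasEigenvalue.exists_hasEigenvector (h1.lt zero_lt_one)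
        exact hμ (hD μ v hv.2 hv.apply_eq_smul)
      rw [hbot, Submodule.mem_bot] at hx
      exact ⟨0, by simp [hx]⟩
  · rintro x y ⟨a, ha⟩ ⟨b, hb⟩
    refine ⟨a + b, ?_⟩
    have e1 : (D ^ (a + b)) x = 0 := by rw [add_comm, pow_add, Module.End.mul_apply, ha, map_zero]
    have e2 : (D ^ (a + b)) y = 0 := by rw [pow_add, Module.End.mul_apply, hb, map_zero]
    rw [map_add, e1, e2, add_zero]

include hBalt cj_cj hcj01 hpos cj_add cj_smul hcompl in
/-- **(L2′) The key linear-algebra step.** Let `Y`, `Y'` be a commuting `B`-adjoint pair of real,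
type-preserving endomorphisms, `Y` with only REAL eigenvalues. Then `Y' = Y`. Proof: every
eigenvalue `δ` of `D = Y - Y'` vanishes — in the `δ`-eigenspace, split by type, `Y` has an
eigenvector `x ≠ 0` of pure type, `Y x = λ x`, `Y' x = (λ - δ) x`, the eigenvalue `λ - δ` of `Y'` is an
eigenvalue of `Y`, and positivity `B x (cj x) ≠ 0` with `B (Y x) (cj x) = B x (Y' (cj x))` gives
`λ = conj (λ - δ) = λ - δ`; so `D` is nilpotent, antisymmetric, real and type-preserving, hence `0`.
[folklore] -/
private theorem eq_of_isAdj_of_comm (hBnd : B.Nondegenerate) {Y Y' : Module.End ℂ V}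
    (hadj : ∀ x y, B (Y' x) y = B x (Y y))
    (hcomm : Y * Y' = Y' * Y) (hY : ∀ x, cj (Y x) = Y (cj x)) (hY' : ∀ x, cj (Y' x) = Y' (cj x))
    (htY : (∀ x ∈ H10, Y x ∈ H10) ∧ (∀ x ∈ H01, Y x ∈ H01))
    (htY' : (∀ x ∈ H10, Y' x ∈ H10) ∧ (∀ x ∈ H01, Y' x ∈ H01))
    (hroots : ∀ (μ : ℂ) (v : V), v ≠ 0 → Y v = μ • v → starRingEnd ℂ μ = μ) : Y' = Y := by
  set D := Y - Y' with hDdef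
  have hDre : ∀ x, cj (D x) = D (cj x) := fun x ↦ by
    rw [hDdef, LinearMap.sub_apply, LinearMap.sub_apply, cj_sub cj_add cj_smul, hY, hY']
  have hDtp : (∀ x ∈ H10, D x ∈ H10) ∧ (∀ x ∈ H01, D x ∈ H01) :=
    ⟨fun x hx ↦ Submodule.sub_mem _ (htY.1 x hx) (htY'.1 x hx),
      fun x hx ↦ Submodule.sub_mem _ (htY.2 x hx) (htY'.2 x hx)⟩
  have hDε : ∀ x y, B (D x) y = (-1) * B x (D y) := fun x y ↦ by
    simp only [hDdef, LinearMap.sub_apply, map_sub, hadj x y, isAdj_apply_right hBalt hadj x y]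
    ring
  -- `Y` commutes with `D`
  have hYD : ∀ v, Y (D v) = D (Y v) := fun v ↦ by
    have h := LinearMap.congr_fun hcomm v
    rw [Module.End.mul_apply, Module.End.mul_apply] at h
    rw [hDdef, LinearMap.sub_apply, LinearMap.sub_apply, map_sub, h]
  -- every eigenvalue of `D` vanishes
  have hzero : ∀ (δ : ℂ) (v : V), v ≠ 0 → D v = δ • v → δ = 0 := by
    intro δ v hv0 hv
    obtain ⟨a, ha, b, hb, hab⟩ := exists_add_eq hcompl v
    have hDa : D a ∈ H10 := hDtp.1 a ha
    have hDb : D b ∈ H01 := hDtp.2 b hb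
    have hsplit : D a = δ • a ∧ D b = δ • b := by
      refine eq_of_add_eq_add hcompl hDa (Submodule.smul_mem _ δ ha) hDb
        (Submodule.smul_mem _ δ hb) ?_
      rw [← map_add, hab, hv, ← smul_add, hab]
    -- a non-zero pure-type `δ`-eigenvector `w`
    obtain ⟨w, hwpure, hw0, hDw⟩ : ∃ w, (w ∈ H10 ∨ w ∈ H01) ∧ w ≠ 0 ∧ D w = δ • w := by
      by_cases ha0 : a = 0
      · refine ⟨b, Or.inr hb, fun hb0 ↦ hv0 ?_, hsplit.2⟩
        rw [← hab, ha0, hb0, add_zero]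
      · exact ⟨a, Or.inl ha, ha0, hsplit.1⟩
    -- the piece containing `w`
    obtain ⟨Hp, hwHp, hHp_pure, hYHp⟩ : ∃ Hp : Submodule ℂ V, w ∈ Hp ∧
        (∀ x ∈ Hp, x ∈ H10 ∨ x ∈ H01) ∧ (∀ x ∈ Hp, Y x ∈ Hp) := by
      rcases hwpure with h | h
      · exact ⟨H10, h, fun x hx ↦ Or.inl hx, htY.1⟩
      · exact ⟨H01, h, fun x hx ↦ Or.inr hx, htY.2⟩
    -- the subspace `S = E_δ ∩ Hp` and a `Y`-eigenvector in it
    set S : Submodule ℂ V := Module.End.eigenspace D δ ⊓ Hp with hS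
    have hwS : w ∈ S := Submodule.mem_inf.2 ⟨Module.End.mem_eigenspace_iff.2 hDw, hwHp⟩
    have hS0 : S ≠ ⊥ := fun h ↦ hw0 ((Submodule.mem_bot ℂ).1 (h ▸ hwS))
    have hYS : Set.MapsTo Y S S := by
      intro x hx
      obtain ⟨hx1, hx2⟩ := Submodule.mem_inf.1 hx
      refine Submodule.mem_inf.2 ⟨Module.End.mem_eigenspace_iff.2 ?_, hYHp x hx2⟩
      rw [← hYD, Module.End.mem_eigenspace_iff.1 hx1, map_smul]
    obtain ⟨lam, x, hxS, hx0, hYx⟩ := exists_eigenvector_of_mapsTo hS0 hYS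
    have hxpure : x ∈ H10 ∨ x ∈ H01 := hHp_pure x (Submodule.mem_inf.1 hxS).2
    have hDx : D x = δ • x := Module.End.mem_eigenspace_iff.1 (Submodule.mem_inf.1 hxS).1
    -- `Y' x = (λ - δ) x`
    have hY'x : Y' x = (lam - δ) • x := by
      have : Y' x = Y x - D x := by rw [hDdef, LinearMap.sub_apply, sub_sub_cancel]
      rw [this, hYx, hDx, sub_smul]
    -- both eigenvalues are real
    have hmu : starRingEnd ℂ (lam - δ) = lam - δ := by
      obtain ⟨x', hx'0, hx'⟩ := isAdj_exists_eigenvector hBnd hadj hx0 hY'x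
      exact hroots _ x' hx'0 hx'
    -- positivity
    have hne := apply_cj_ne_zero_of_pure hBalt cj_add cj_cj hcj01 hpos hxpure hx0
    have e1 : B (Y x) (cj x) = lam * B x (cj x) := by
      rw [hYx, map_smul, LinearMap.smul_apply, smul_eq_mul]
    have e2 : B (Y x) (cj x) = starRingEnd ℂ (lam - δ) * B x (cj x) := by
      rw [← isAdj_apply_right hBalt hadj, ← hY', hY'x, cj_smul, LinearMap.map_smul, smul_eq_mul]
    rw [hmu, e1] at e2
    have e3 : (lam - (lam - δ)) * B x (cj x) = 0 := by rw [sub_mul, e2, sub_self]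
    rcases mul_eq_zero.1 e3 with h | h
    · simpa using h
    · exact absurd h hne
  have hDnil : IsNilpotent D := isNilpotent_of_forall_eigenvalue_eq_zero hzero
  have hD0 : D = 0 := eq_zero_of_isNilpotent hBalt cj_add cj_cj hcompl hcj01 hpos hDre hDtp hDε hDnil
  rw [hDdef, sub_eq_zero] at hD0
  exact hD0.symm

end Positivity

/-! ### 0d. A commutative group of involutions of a finite-dimensional space is finite -/

section Involutions

omit [FiniteDimensional ℂ V] in
/-- For an involution `T` (`T² = 1`), generalized eigenvectors are eigenvectors. [folklore] -/
private theorem apply_eq_smul_of_pow_apply_eq_zero_of_sq {T : Module.End ℂ V} (hT : T * T = 1) {c : ℂ} :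
    ∀ (k : ℕ) (v : V), ((T - c • 1) ^ k) v = 0 → T v = c • v
  | 0, v, hv => by
    simp only [pow_zero, Module.End.one_apply] at hv
    rw [hv, map_zero, smul_zero]
  | k + 1, v, hv => by
    rw [pow_succ, Module.End.mul_apply] at hv
    have hTu := apply_eq_smul_of_pow_apply_eq_zero_of_sq hT k _ hv
    have hTT : ∀ w, T (T w) = w := fun w ↦ by rw [← Module.End.mul_apply, hT, Module.End.one_apply]
    have hu : (T - c • 1) v = T v - c • v := by simp
    rw [hu] at hTu
    -- `hTu : T (T v - c • v) = c • (T v - c • v)`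
    by_cases hc : c * c = 1
    · have e1 : v - c • T v = c • T v - (c * c) • v := by
        rw [mul_smul, ← smul_sub, ← hTu, map_sub, hTT, map_smul]
      rw [hc, one_smul, sub_eq_sub_iff_add_eq_add, ← two_smul ℂ, ← two_smul ℂ] at e1
      have e2 : v = c • T v := smul_right_injective V (two_ne_zero (α := ℂ)) e1
      calc T v = T (c • T v) := by rw [← e2]
        _ = c • v := by rw [map_smul, hTT]
    · set u := T v - c • v with hudef
      have h3 : T u = c • u := hTu
      have h2 : u = (c * c) • u := by
        have := hTT u
        rw [h3, map_smul, h3, smul_smul] at this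
        exact this.symm
      have e3 : (1 - c * c) • u = 0 := by rw [sub_smul, one_smul, ← h2, sub_self]
      have hu0 : u = 0 := by
        rcases smul_eq_zero.1 e3 with h | h
        · exact absurd (sub_eq_zero.1 h).symm hc
        · exact h
      rw [hudef] at hu0
      exact sub_eq_zero.1 hu0

/-- **A commutative subgroup of `GL(V)` consisting of involutions is finite** (`V` a finite-dimensional
complex vector space): its elements act by scalars `±1` on the finitely many simultaneous eigenspaces,
which span `V`. [folklore] -/
private theorem finite_of_comm_of_mul_self_eq_one (G : Subgroup (V ≃ₗ[ℂ] V))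
    (hcomm : ∀ a ∈ G, ∀ b ∈ G, a * b = b * a) (hsq : ∀ a ∈ G, a * a = 1) : Finite G := by
  classical
  let f : G → Module.End ℂ V := fun a ↦ ((a : V ≃ₗ[ℂ] V) : Module.End ℂ V)
  have hf1 : ∀ a : G, f a * f a = 1 := fun a ↦ by
    refine LinearMap.ext fun v ↦ ?_
    have h := LinearEquiv.congr_fun (hsq a a.2) v
    rw [LinearEquiv.mul_apply] at h
    rw [Module.End.mul_apply, Module.End.one_apply]
    exact h
  have hfc : ∀ a b : G, Commute (f a) (f b) := fun a b ↦ by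
    refine LinearMap.ext fun v ↦ ?_
    have h := LinearEquiv.congr_fun (hcomm a a.2 b b.2) v
    rw [LinearEquiv.mul_apply, LinearEquiv.mul_apply] at h
    change f a (f b v) = f b (f a v)
    exact h
  -- simultaneous generalized eigenspaces
  let P : (G → ℂ) → Submodule ℂ V := fun χ ↦ ⨅ a, (f a).maxGenEigenspace (χ a)
  have hind : iSupIndep P :=
    Module.End.independent_iInf_maxGenEigenspace_of_forall_mapsTo f fun a b φ ↦
      Module.End.mapsTo_maxGenEigenspace_of_comm (hfc b a) φ
  have htop : ⨆ χ, P χ = ⊤ :=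
    Module.End.iSup_iInf_maxGenEigenspace_eq_top_of_iSup_maxGenEigenspace_eq_top_of_commute f
      (fun a b _ ↦ hfc a b) fun a ↦ Module.End.iSup_maxGenEigenspace_eq_top (f a)
  -- on `P χ`, `a` acts by the scalar `χ a`
  have hact : ∀ (χ : G → ℂ) (a : G), ∀ v ∈ P χ, f a v = χ a • v := by
    intro χ a v hv
    have hv' : v ∈ (f a).maxGenEigenspace (χ a) := (Submodule.mem_iInf _).1 hv a
    obtain ⟨k, hk⟩ := (Module.End.mem_maxGenEigenspace _ _ _).1 hv'
    exact apply_eq_smul_of_pow_apply_eq_zero_of_sq (hf1 a) k v hk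
  -- the finitely many occurring characters and their values
  haveI : Fintype {χ : G → ℂ // P χ ≠ ⊥} := hind.fintypeNeBotOfFiniteDimensional
  have hSfin : ({c : ℂ | c ^ 2 = 1} : Set ℂ).Finite := by
    refine (Multiset.finite_toSet (Polynomial.nthRoots 2 (1 : ℂ))).subset fun x hx ↦ ?_
    exact (Polynomial.mem_nthRoots two_pos).2 hx
  haveI : Finite {c : ℂ // c ^ 2 = 1} := hSfin.to_subtype
  have hval : ∀ (χ : {χ : G → ℂ // P χ ≠ ⊥}) (a : G), (χ.1 a) ^ 2 = 1 := by
    intro χ a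
    obtain ⟨v, hv, hv0⟩ := Submodule.exists_mem_ne_zero_of_ne_bot χ.2
    have h1 := hact χ.1 a v hv
    have h2 : f a (f a v) = v := by rw [← Module.End.mul_apply, hf1, Module.End.one_apply]
    rw [h1, map_smul, h1, smul_smul] at h2
    have : (χ.1 a ^ 2 - 1) • v = 0 := by rw [sub_smul, one_smul, sq, h2, sub_self]
    rcases smul_eq_zero.1 this with h | h
    · exact sub_eq_zero.1 h
    · exact absurd h hv0
  let F : G → ({χ : G → ℂ // P χ ≠ ⊥} → {c : ℂ // c ^ 2 = 1}) := fun a χ ↦ ⟨χ.1 a, hval χ a⟩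
  refine Finite.of_injective F fun a b hab ↦ ?_
  -- `a = b` on every `P χ`, hence everywhere
  apply Subtype.ext
  refine LinearEquiv.ext fun v ↦ ?_
  have hv : v ∈ ⨆ χ, P χ := by rw [htop]; exact Submodule.mem_top
  refine Submodule.iSup_induction (motive := fun v ↦ (a : V ≃ₗ[ℂ] V) v = (b : V ≃ₗ[ℂ] V) v) P hv
    ?_ ?_ ?_
  · intro χ v hv
    by_cases hχ : P χ = ⊥
    · rw [hχ, Submodule.mem_bot] at hv
      rw [hv, map_zero, map_zero]
    · have e : χ a = χ b := congrArg Subtype.val (congr_fun hab ⟨χ, hχ⟩)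
      change f a v = f b v
      rw [hact χ a v hv, hact χ b v hv, e]
  · rw [map_zero, map_zero]
  · intro x y hx hy
    rw [map_add, map_add, hx, hy]

end Involutions

end HodgeGroupSemisimple

/-! ## Part 1. The carriers: the polarization form `B` on `H¹(A(ℂ); ℂ)` -/

open CategoryTheory
open scoped TensorProduct
open Literature.AlgebraicTopology.SingularHomology
open Literature.AlgebraicGeometry.Motives
open Literature.AlgebraicGeometry.VanGeemen1994 (pullbackOne hodgeGroupOne mem_hodgeGroupOne_iff)
open Literature.AlgebraicGeometry.Milne1999 (centralizerAlgebra centralizerGroup unitaryCentralizerGroup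
  mem_centralizerAlgebra_iff mem_centralizerAlgebra_iff' centralizerAlgebra_eq_centralizer_span
  hodgeGroupOne_le_centralizerGroup mem_centralizerGroup_iff)
open Literature.Geometry.Kaehler (HasHardLefschetzProperty)
open Literature.FieldTheory.AlgClosed

namespace HodgeGroupSemisimple

variable {A : AbelianVariety ℂ}

/-! ### 1a. A polarization class: rational, of type `(1,1)`, hard Lefschetz, Hodge–Riemann positive -/

/-- For `N ≥ 1` there is a non-zero rational class in `H²(ℙᴺ(ℂ); ℂ)` (private copy of
`HodgeTheory.exists_isRationalClass_ne_zero_projectiveSpace`, file `WeilFamilyBalanced`, not imported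
here). [cite: HatcherAT2002, Thm. 3.19] [cite: VoisinHodgeI2002, §7.1.1] -/
private theorem exists_isRationalClass_ne_zero_projectiveSpace_two {N : ℕ} (hN : 1 ≤ N) :
    ∃ r₀ : complexBetti (projectiveSpace N ℂ) 2, IsRationalClass r₀ ∧ r₀ ≠ 0 := by
  have hP : IsSmoothProjective N (projectiveSpace N ℂ) := isSmoothProjective_projectiveSpace' N
  have h1 : Module.finrank ℂ (complexBetti (projectiveSpace N ℂ) 2) = 1 :=
    finrank_complexBetti_projectiveSpace_two_mul_eq_one N (p := 1) hN
  have hspan := span_isRationalClass_eq_top_of_isSmoothProjective_holds N (projectiveSpace N ℂ) hP 2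
  by_contra hcon
  have hbot : Submodule.span ℂ {c : complexBetti (projectiveSpace N ℂ) 2 | IsRationalClass c} = ⊥ :=
    Submodule.span_eq_bot.2 fun c hc ↦ by_contra fun h0 ↦ hcon ⟨c, hc, h0⟩
  rw [hspan] at hbot
  haveI : Subsingleton (complexBetti (projectiveSpace N ℂ) 2) :=
    subsingleton_of_forall_eq 0 fun c ↦ (Submodule.mem_bot ℂ).1 (hbot ▸ Submodule.mem_top)
  rw [Module.finrank_zero_of_subsingleton] at h1
  exact zero_ne_one h1

/-- **A polarization class on `H¹(A(ℂ); ℂ)`** (`dim A ≥ 1`): the hyperplane class `h = e^*a` of a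
projective embedding `e : A ↪ ℙᴺ` (`a ≠ 0` rational) is rational, of Hodge type `(1,1)`, has the hard
Lefschetz property (it is a non-zero real multiple of a Kähler class, Voisin I Thm. 6.25 / §7.1.2), and
satisfies the Hodge–Riemann relation in degree one: `Q_h(x, x̄) = h^{dim A - 1} ∪ x ∪ x̄ ≠ 0` for every
non-zero class `x` of type `(1,0)` (Voisin I Thm. 6.32; the tree's `hodgeRiemann_degreeOne_of_isOfHodgeType`).
[cite: VoisinHodgeI2002, Thm. 6.25, Thm. 6.32 and §7.1.2] [cite: vanGeemen1994HodgeAV, Lemma 5.2 (1)] -/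
theorem exists_polarizationClass (h1 : 1 ≤ A.dim) :
    ∃ h : complexBetti A.X 2, IsRationalClass h ∧ IsOfHodgeType A.dim A.X 2 1 1 h ∧
      HasHardLefschetzProperty h A.dim ∧
      ∀ x ∈ hodgeOneZero (AbelianVariety.isSmoothProjective_holds (A := A)), x ≠ 0 →
        polarizationPairingOne A.X h (A.dim - 1) x (conjClass (ComplexPoints A.X) 1 x) ≠ 0 := by
  have hX : IsSmoothProjective A.dim A.X := AbelianVariety.isSmoothProjective_holds
  have hA : A.dim = (A.dim - 1) + 1 := (Nat.sub_add_cancel h1).symm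
  have hX' : IsSmoothProjective (A.dim - 1 + 1) A.X := by rw [← hA]; exact hX
  let e : ProjectiveEmbedding A.X := hX.isProjectiveOver.projectiveEmbedding
  have hN : 1 ≤ e.n := le_trans h1 (le_of_isClosedImmersion_projectiveSpace hX e.ι)
  obtain ⟨a, ha, ha0⟩ := exists_isRationalClass_ne_zero_projectiveSpace_two hN
  obtain ⟨s, H', hs0, hK, hsH⟩ :=
    exists_isKaehlerClass_ksymm_eq_smul (m := A.dim - 1) (d := 1) hA one_pos (𝟙 A) e ha ha0
  have hid : complexBetti.map (𝟙 A : A ⟶ A).hom.hom.hom 2 (complexBetti.map e.ι 2 a) =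
      complexBetti.map e.ι 2 a := by
    change complexBetti.map (𝟙 A.X) 2 (complexBetti.map e.ι 2 a) = _
    rw [complexBetti.map_id]
    rfl
  have h2 : (2 : ℂ) • complexBetti.map e.ι 2 a = (s : ℂ) • H' := by
    rw [← hsH, hid, Nat.cast_one, one_smul, two_smul]
  have hs2 : ((s : ℂ) / 2) ≠ 0 := div_ne_zero (Complex.ofReal_ne_zero.2 hs0) two_ne_zero
  have hhH : complexBetti.map e.ι 2 a = ((s : ℂ) / 2) • H' := by
    rw [div_eq_inv_mul, mul_smul, ← h2, smul_smul, inv_mul_cancel₀ (two_ne_zero (α := ℂ)), one_smul]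
  refine ⟨complexBetti.map e.ι 2 a, ha.map _, ?_, ?_, ?_⟩
  · rw [hhH]
    have h11 := hK.isOfHodgeType_one_one
    rw [← hA] at h11
    exact h11.smul _
  · rw [hhH]
    have hHL := hK.hasHardLefschetzProperty hX' fun _ ↦ Motives.hasHardLefschetzProperty_kaehlerClass_holds
    have hHL' : HasHardLefschetzProperty H' A.dim := fun j k hjk ↦ hHL j k (hjk.trans hA)
    exact HasHardLefschetzProperty.smul hHL' hs2
  · intro x hx hx0
    obtain ⟨ω₀, -, hω0, hpos⟩ := hodgeRiemann_degreeOne_of_isOfHodgeType hX' e ha ha0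
    have hx' : IsOfHodgeType (A.dim - 1 + 1) A.X 1 1 0 x := by rw [← hA]; exact hx
    obtain ⟨t, ht, hQ⟩ := hpos x hx' hx0
    intro hzero
    rw [hzero, smul_zero] at hQ
    rcases smul_eq_zero.1 hQ.symm with h | h
    · exact ht.ne' (Complex.ofReal_eq_zero.1 h)
    · exact hω0 h

/-! ### 1b. A real coordinate on the line `H^{2 dim A}(A(ℂ); ℂ)` -/

/-- **A conjugation-compatible coordinate on the top cohomology** `H^{2 + 2(dim A - 1)}(A(ℂ); ℂ) ≅ ℂ`:
an injective functional `coord` with `coord (x̄) = conj (coord x)` (normalise a coordinate at a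
rational generator of the line). [cite: HatcherAT2002, §3.3 Cor. 3.37] [cite: VoisinHodgeI2002, §6.1.3 Cor. 6.12] -/
theorem exists_coord (h1 : 1 ≤ A.dim) :
    ∃ coord : complexBetti A.X (2 + 2 * (A.dim - 1)) →ₗ[ℂ] ℂ, Function.Injective coord ∧
      ∀ w, coord (conjClass (ComplexPoints A.X) (2 + 2 * (A.dim - 1)) w) = starRingEnd ℂ (coord w) := by
  have hX : IsSmoothProjective A.dim A.X := AbelianVariety.isSmoothProjective_holds
  have hA : A.dim = (A.dim - 1) + 1 := (Nat.sub_add_cancel h1).symm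
  have hX' : IsSmoothProjective (A.dim - 1 + 1) A.X := by rw [← hA]; exact hX
  haveI : Module.Finite ℂ (complexBetti A.X (2 + 2 * (A.dim - 1))) := finite_complexBetti_abelianVariety A _
  have hfr := Motives.finrank_complexBetti_two_add_two_mul_eq_one hX'
  obtain ⟨ω₁, hωrat, hω0⟩ := Motives.exists_isRationalClass_ne_zero_two_add_two_mul hX'
  have hline : ∀ w : complexBetti A.X (2 + 2 * (A.dim - 1)), ∃ c : ℂ, c • ω₁ = w :=
    (finrank_eq_one_iff_of_nonzero' ω₁ hω0).1 hfr
  let b := Module.finBasisOfFinrankEq ℂ (complexBetti A.X (2 + 2 * (A.dim - 1))) hfr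
  set lam : complexBetti A.X (2 + 2 * (A.dim - 1)) →ₗ[ℂ] ℂ := b.coord 0 with hlam
  have hlamω : lam ω₁ ≠ 0 := by
    intro h0
    obtain ⟨c, hc⟩ := hline (b 0)
    have hb0 : lam (b 0) = 1 := by
      rw [hlam, Module.Basis.coord_apply, Module.Basis.repr_self, Finsupp.single_eq_same]
    rw [← hc, map_smul, smul_eq_mul, h0, mul_zero] at hb0
    exact zero_ne_one hb0
  have hcoord : ∀ c : ℂ, ((lam ω₁)⁻¹ • lam) (c • ω₁) = c := fun c ↦ by
    rw [LinearMap.smul_apply, map_smul, smul_eq_mul, smul_eq_mul, mul_comm c, ← mul_assoc,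
      inv_mul_cancel₀ hlamω, one_mul]
  refine ⟨(lam ω₁)⁻¹ • lam, fun w w' hww' ↦ ?_, fun w ↦ ?_⟩
  · obtain ⟨c, rfl⟩ := hline w
    obtain ⟨c', rfl⟩ := hline w'
    rw [hcoord, hcoord] at hww'
    rw [hww']
  · obtain ⟨c, rfl⟩ := hline w
    rw [conjClass_smul, hωrat.conjClass_eq, hcoord, hcoord]

/-! ### 1c. Type preservation for endomorphisms commuting with the Hodge group -/

/-- **An endomorphism of `H¹(A(ℂ); ℂ)` commuting with the Hodge group preserves `H^{1,0}` and
`H^{0,1}`** (Deligne I Prop. 3.4: it commutes with the Hodge operators; the tree's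
`Deligne1982.mem_typePiece_of_commute_hodgeGroup`, read on the model-free pieces `hodgeOneZero`,
`hodgeZeroOne`). [cite: Deligne1982HodgeCycles, I §3 Prop. 3.4] -/
theorem preservesType_of_commute_hodgeGroup (T : Module.End ℂ (complexBetti A.X 1))
    (hT : ∀ g ∈ hodgeGroup A.dim A.X, ∀ y : complexBetti A.X 1, T (g 1 y) = g 1 (T y)) :
    (∀ x ∈ hodgeOneZero (AbelianVariety.isSmoothProjective_holds (A := A)),
        T x ∈ hodgeOneZero (AbelianVariety.isSmoothProjective_holds (A := A))) ∧
      (∀ x ∈ hodgeZeroOne (AbelianVariety.isSmoothProjective_holds (A := A)),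
        T x ∈ hodgeZeroOne (AbelianVariety.isSmoothProjective_holds (A := A))) := by
  have hX : IsSmoothProjective A.dim A.X := AbelianVariety.isSmoothProjective_holds
  obtain ⟨M⟩ := nonempty_hodgeModel_holds hX
  let p10 : ↥(Finset.HasAntidiagonal.antidiagonal 1) := ⟨(1, 0), Finset.HasAntidiagonal.mem_antidiagonal.2 rfl⟩
  let p01 : ↥(Finset.HasAntidiagonal.antidiagonal 1) := ⟨(0, 1), Finset.HasAntidiagonal.mem_antidiagonal.2 rfl⟩
  refine ⟨fun x hx ↦ ?_, fun x hx ↦ ?_⟩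
  · have hx' : x ∈ M.typePiece 1 p10 := (M.mem_typePiece_iff_isOfHodgeType' hX p10 x).2 hx
    exact (M.mem_typePiece_iff_isOfHodgeType' hX p10 _).1
      (Deligne1982.mem_typePiece_of_commute_hodgeGroup M hX T hT hx')
  · have hx' : x ∈ M.typePiece 1 p01 := (M.mem_typePiece_iff_isOfHodgeType' hX p01 x).2 hx
    exact (M.mem_typePiece_iff_isOfHodgeType' hX p01 _).1
      (Deligne1982.mem_typePiece_of_commute_hodgeGroup M hX T hT hx')

/-- A pull-back `φ^*` commutes with the Hodge group on `H¹` (the graph class of `φ` is a Hodge class;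
the tree's `hodgeGroup_apply_map`). [cite: Deligne1982HodgeCycles, I §3 Prop. 3.4] [cite: vanGeemen1994HodgeAV, 6.9] -/
theorem pullbackOne_commute_hodgeGroup (u : A ⟶ A) :
    ∀ g ∈ hodgeGroup A.dim A.X, ∀ y : complexBetti A.X 1,
      pullbackOne A u (g 1 y) = g 1 (pullbackOne A u y) := fun _ hg y ↦
  (hodgeGroup_apply_map AbelianVariety.isSmoothProjective_holds hg u.hom.hom.hom 1 y).symm

/-- `(φ ≫ ψ)^* = φ^* ∘ ψ^*` on `H¹`, in `Module.End`. [folklore] -/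
private theorem pullbackOne_comp' (φ ψ : A ⟶ A) : pullbackOne A (φ ≫ ψ) = pullbackOne A φ * pullbackOne A ψ := by
  change (complexBetti.map (φ.hom.hom.hom ≫ ψ.hom.hom.hom) 1).hom = _
  rw [complexBetti.map_comp, ModuleCat.hom_comp]
  rfl

/-! ### 1d. Real eigenvalues of central pull-backs (the hypothesis "no factor of type IV") -/

/-- **A pull-back `u^*` lying in Milne's centraliser `C(A) ⊗ ℂ` comes from a CENTRAL endomorphism,
and — when `A` has no factor of type IV — has only real eigenvalues on `H¹(A(ℂ); ℂ)`.** `u` commutes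
with every `φ ∈ End(A)` (the complex representation is faithful, `hom_eq_zero_of_complexBetti_map_one_eq_zero`),
so `1 ⊗ u` is central in `End⁰(A)`; `HasNoTypeIVFactor` gives a non-zero `f ∈ ℚ[T]` with only real
complex roots and `f(1 ⊗ u) = 0`; clearing denominators (`IsLocalization.integerNormalization`) and
using `End(A) ↪ End⁰(A)` (`endAlgebra.of_injective_of_charZero`), `P(u) = 0` in `End(A)` for an integer
multiple `P` of `f`, hence `P(u^*) = 0` on `H¹` (`aeval_hom_complexBetti_map_one_eq_zero`) and every
eigenvalue of `u^*` is a root of `P`, i.e. of `f`. [cite: MoonenZarhin1999LowDim, §1]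
[cite: LangeBirkenhake1992, §1.2 (the rational representation is faithful) and §5.5 (Albert types)] -/
theorem conj_eigenvalue_pullbackOne (hA4 : HasNoTypeIVFactor A) (u : A ⟶ A)
    (huC : pullbackOne A u ∈ centralizerAlgebra A) {μ : ℂ} {v : complexBetti A.X 1} (hv : v ≠ 0)
    (hμ : pullbackOne A u v = μ • v) : starRingEnd ℂ μ = μ := by
  -- (i) `u` is central in `End A`
  have hcomm : ∀ φ : A ⟶ A, φ ≫ u = u ≫ φ := by
    intro φ
    have h := (mem_centralizerAlgebra_iff.1 huC) φ
    have e : pullbackOne A (φ ≫ u) = pullbackOne A (u ≫ φ) := by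
      rw [pullbackOne_comp', pullbackOne_comp', h]
    have e0 : (complexBetti.map (φ ≫ u - u ≫ φ).hom.hom.hom 1).hom = 0 := by
      rw [complexBetti_map_sub_one, ModuleCat.hom_sub]
      exact sub_eq_zero.2 e
    exact sub_eq_zero.1 (ComplexMultiplication.hom_eq_zero_of_complexBetti_map_one_eq_zero _ e0)
  have hcent : AbelianVariety.endAlgebra.of A u ∈ Subalgebra.center ℚ A.endAlgebra := by
    rw [Subalgebra.mem_center_iff]
    intro ξ
    obtain ⟨N, F, -, rfl⟩ := AbelianVariety.endAlgebra.exists_eq_algebraMap_mul_of ξ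
    have hFu : AbelianVariety.endAlgebra.of A F * AbelianVariety.endAlgebra.of A u =
        AbelianVariety.endAlgebra.of A u * AbelianVariety.endAlgebra.of A F := by
      rw [← map_mul, ← map_mul]
      exact congrArg _ (hcomm F).symm
    rw [mul_assoc, hFu, ← mul_assoc, ← mul_assoc, Algebra.commutes]
  -- (ii) the annihilating polynomial, with integer coefficients
  obtain ⟨f, -, hfu, hreal⟩ := hA4 _ hcent
  set P : Polynomial ℤ := IsLocalization.integerNormalization (nonZeroDivisors ℤ) f with hP
  obtain ⟨b, hbM, hb⟩ := IsLocalization.integerNormalization_spec (nonZeroDivisors ℤ) f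
  rw [← hP, ← algebraMap_smul ℚ b f, Polynomial.smul_eq_C_mul] at hb
  have hPu : Polynomial.eval₂ ((algebraMap ℚ A.endAlgebra).comp (algebraMap ℤ ℚ))
      (AbelianVariety.endAlgebra.of A u) P = 0 := by
    rw [← Polynomial.eval₂_map, hb, ← Polynomial.aeval_def, map_mul, hfu, mul_zero]
  have hPu' : Polynomial.eval₂ (Int.castRingHom (CategoryTheory.End A)) (End.of u) P = 0 := by
    apply AbelianVariety.endAlgebra.of_injective_of_charZero (A := A)
    rw [map_zero, Polynomial.hom_eval₂,
      RingHom.ext_int ((AbelianVariety.endAlgebra.of A).comp (Int.castRingHom (CategoryTheory.End A)))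
        ((algebraMap ℚ A.endAlgebra).comp (algebraMap ℤ ℚ))]
    exact hPu
  have hY : Polynomial.aeval (pullbackOne A u) (P.map (Int.castRingHom ℂ)) = 0 :=
    aeval_hom_complexBetti_map_one_eq_zero hPu'
  -- (iii) `μ` is a root of `P`, hence of `f`
  have hroot : (P.map (Int.castRingHom ℂ)).eval μ = 0 := by
    have hvec : Module.End.HasEigenvector (pullbackOne A u) μ v := ⟨Module.End.mem_eigenspace_iff.2 hμ, hv⟩
    have h := Module.End.aeval_apply_of_hasEigenvector (p := P.map (Int.castRingHom ℂ)) hvec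
    rw [hY, LinearMap.zero_apply] at h
    rcases smul_eq_zero.1 h.symm with h' | h'
    · exact h'
    · exact absurd h' hv
  have hfμ : Polynomial.aeval μ f = 0 := by
    have e1 : Polynomial.aeval μ (P.map (algebraMap ℤ ℚ)) = 0 := by
      rw [Polynomial.aeval_map_algebraMap, Polynomial.aeval_def, algebraMap_int_eq, ← Polynomial.eval_map]
      exact hroot
    rw [hb, map_mul, Polynomial.aeval_C] at e1
    refine (mul_eq_zero.1 e1).resolve_left ?_
    have hb0 : (b : ℚ) ≠ 0 := by exact_mod_cast nonZeroDivisors.ne_zero hbM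
    simpa using hb0
  exact Complex.conj_eq_iff_im.2 (hreal μ hfμ)

/-! ### 1e. Descent: the commutant data is spanned by central pull-backs (Deligne I Prop. 3.4 + Riemann) -/

/-- **Galois descent with the centraliser condition.** Every `ℂ`-linear endomorphism of `H¹(A(ℂ); ℂ)`
commuting with the Hodge group `Hg(A)(ℂ)` AND with every pull-back `φ^*`, `φ ∈ End(A)`, lies in the
`ℂ`-span of the pull-backs `u^*` which themselves commute with every `φ^*` (`u^* ∈ C(A) ⊗ ℂ`). This is
the tree's `Deligne1982.mem_span_complexBetti_map_of_commute_hodgeGroup` (Deligne I Prop. 3.4 for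
`End(H¹)` + Riemann's theorem, Deligne–Milne II 6.20, PROVED in the tree) with the extra, Galois-stable,
linear condition "commutes with the rational operators `φ^*`" carried through the descent
(`Complex.submodule_le_span_fixed_of_forall_ringEquiv`): the centre `Z(End⁰(A) ⊗ ℂ)` of the
endomorphism algebra acting on `H¹` is `Z(End⁰(A)) ⊗ ℂ`. [cite: Deligne1982HodgeCycles, I §3, Prop. 3.4 and its proof]
[cite: DeligneMilne1982Tannakian, II Thm. 6.20] [cite: Borel1991, AG §14.2] -/
theorem mem_span_pullbackOne_of_commute (A : AbelianVariety ℂ)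
    (x : complexBetti A.X 1 →ₗ[ℂ] complexBetti A.X 1)
    (hx : ∀ g ∈ hodgeGroup A.dim A.X, ∀ y : complexBetti A.X 1, x (g 1 y) = g 1 (x y))
    (hx' : ∀ (φ : A ⟶ A) (y : complexBetti A.X 1), x (pullbackOne A φ y) = pullbackOne A φ (x y)) :
    x ∈ Submodule.span ℂ {Y : Module.End ℂ (complexBetti A.X 1) |
      ∃ u : A ⟶ A, Y = pullbackOne A u ∧ pullbackOne A u ∈ centralizerAlgebra A} := by
  classical
  have hX : IsSmoothProjective A.dim A.X := AbelianVariety.isSmoothProjective_holds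
  obtain ⟨M⟩ := nonempty_hodgeModel_holds hX
  -- a rational basis of `H¹(A(ℂ); ℂ)`
  haveI : Module.Finite ℚ (bettiCohomology A.X 1) := finite_singularCohomology_rat_complexPoints hX 1
  set β := ofRatClassBaseChangeEquiv hX 1 with hβdef
  set d := Module.finrank ℚ (bettiCohomology A.X 1) with hd
  let b : Module.Basis (Fin d) ℚ (bettiCohomology A.X 1) := Module.finBasis ℚ (bettiCohomology A.X 1)
  let Bc : Module.Basis (Fin d) ℂ (ℂ ⊗[ℚ] bettiCohomology A.X 1) := Algebra.TensorProduct.basis ℂ b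
  let B : Module.Basis (Fin d) ℂ (complexBetti A.X 1) := Bc.map β
  have hBc : ∀ i, Bc i = (1 : ℂ) ⊗ₜ b i := fun i ↦ Algebra.TensorProduct.basis_apply b i
  have hB : ∀ i, B i = ofRatClass (ComplexPoints A.X) 1 (b i) := fun i ↦ by
    change β (Bc i) = _
    rw [hBc, hβdef, ofRatClassBaseChangeEquiv_apply, ofRatClassBaseChange_tmul, one_smul]
  have hBrat : ∀ i, IsRationalClass (B i) := fun i ↦ by
    rw [hB]; exact isRationalClass_ofRatClass _
  -- (1) coordinates of a coefficient-twisted class are the twisted coordinates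
  have hrepr : ∀ (τ : ℂ →+* ℂ) (v : complexBetti A.X 1) (i : Fin d),
      B.repr (coeffClass (R := ℂ) (S := ℂ) τ.toAddMonoidHom 1 v) i = τ (B.repr v i) := by
    intro τ v i
    have hv : coeffClass (R := ℂ) (S := ℂ) τ.toAddMonoidHom 1 v =
        ∑ j, τ (B.repr v j) • B j := by
      conv_lhs => rw [← B.sum_repr v]
      rw [map_sum]
      exact Finset.sum_congr rfl fun j _ ↦ by
        rw [coeffClass_ringHom_smul, (hBrat j).coeffClass_ringHom_eq τ]
    rw [hv, B.repr_sum_self]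
  -- (2) the matrix of `x` and of its Galois conjugates
  set m : Matrix (Fin d) (Fin d) ℂ := LinearMap.toMatrix B B x with hm
  have hconj : ∀ (σ : ℂ ≃+* ℂ) (v : complexBetti A.X 1),
      Matrix.toLin B B (m.map σ) v =
        coeffClass (R := ℂ) (S := ℂ) σ.toRingHom.toAddMonoidHom 1
          (x (coeffClass (R := ℂ) (S := ℂ) σ.symm.toRingHom.toAddMonoidHom 1 v)) := by
    intro σ v
    refine B.ext_elem fun i ↦ ?_
    rw [Matrix.repr_toLin, hrepr, ← LinearMap.toMatrix_mulVec_repr B B x, ← hm]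
    simp only [Matrix.mulVec, dotProduct, Matrix.map_apply, map_sum, map_mul]
    refine Finset.sum_congr rfl fun j _ ↦ ?_
    rw [hrepr]
    congr 1
    exact (σ.apply_symm_apply _).symm
  -- (3) the stable subspace of matrices (flattened to `Fin d × Fin d → ℂ`)
  let Pres : (complexBetti A.X 1 →ₗ[ℂ] complexBetti A.X 1) → Prop := fun f ↦
    (∀ (pq : ↥(Finset.HasAntidiagonal.antidiagonal 1)), ∀ c ∈ M.typePiece 1 pq, f c ∈ M.typePiece 1 pq) ∧
    ∀ (φ : A ⟶ A) (c : complexBetti A.X 1), f (pullbackOne A φ c) = pullbackOne A φ (f c)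
  have Pres_add : ∀ f g, Pres f → Pres g → Pres (f + g) := fun f g hf hg ↦
    ⟨fun pq c hc ↦ by rw [LinearMap.add_apply]; exact Submodule.add_mem _ (hf.1 pq c hc) (hg.1 pq c hc),
      fun φ c ↦ by rw [LinearMap.add_apply, LinearMap.add_apply, hf.2, hg.2, map_add]⟩
  have Pres_smul : ∀ (a : ℂ) f, Pres f → Pres (a • f) := fun a f hf ↦
    ⟨fun pq c hc ↦ by rw [LinearMap.smul_apply]; exact Submodule.smul_mem _ a (hf.1 pq c hc),
      fun φ c ↦ by rw [LinearMap.smul_apply, LinearMap.smul_apply, hf.2, map_smul]⟩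
  have Pres_zero : Pres 0 :=
    ⟨fun pq c _ ↦ by rw [LinearMap.zero_apply]; exact Submodule.zero_mem _,
      fun φ c ↦ by rw [LinearMap.zero_apply, LinearMap.zero_apply, map_zero]⟩
  let toEnd : (Fin d × Fin d → ℂ) →ₗ[ℂ] (complexBetti A.X 1 →ₗ[ℂ] complexBetti A.X 1) :=
    { toFun := fun w ↦ Matrix.toLin B B (Matrix.of fun i j ↦ w (i, j))
      map_add' := fun w w' ↦ by
        rw [← map_add]; rfl
      map_smul' := fun a w ↦ by
        rw [RingHom.id_apply, ← map_smul]; rfl }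
  have htoEnd : ∀ w, toEnd w = Matrix.toLin B B (Matrix.of fun i j ↦ w (i, j)) := fun w ↦ rfl
  let S : Submodule ℂ (Fin d × Fin d → ℂ) :=
    { carrier := {w | ∀ σ : ℂ ≃+* ℂ, Pres (toEnd (⇑σ ∘ w))}
      add_mem' := fun {w w'} hw hw' σ ↦ by
        have e : (⇑σ ∘ (w + w')) = (⇑σ ∘ w) + (⇑σ ∘ w') := funext fun ij ↦ map_add σ _ _
        rw [e, map_add]
        exact Pres_add _ _ (hw σ) (hw' σ)
      zero_mem' := fun σ ↦ by
        have e : (⇑σ ∘ (0 : Fin d × Fin d → ℂ)) = 0 := funext fun ij ↦ map_zero σ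
        rw [e, map_zero]
        exact Pres_zero
      smul_mem' := fun a w hw σ ↦ by
        have e : (⇑σ ∘ (a • w)) = σ a • (⇑σ ∘ w) := funext fun ij ↦ map_mul σ _ _
        rw [e, map_smul]
        exact Pres_smul _ _ (hw σ) }
  have hS_mem : ∀ w, w ∈ S ↔ ∀ σ : ℂ ≃+* ℂ, Pres (toEnd (⇑σ ∘ w)) := fun w ↦ Iff.rfl
  have hS : ∀ ρ : ℂ ≃+* ℂ, ∀ w ∈ S, (⇑ρ ∘ w) ∈ S := by
    intro ρ w hw
    rw [hS_mem]
    intro σ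
    have e : (⇑σ ∘ (⇑ρ ∘ w)) = (⇑(ρ.trans σ) ∘ w) := rfl
    rw [e]
    exact (hS_mem w).1 hw (ρ.trans σ)
  -- (4) the flattened matrix of `x` lies in `S`
  set wx : Fin d × Fin d → ℂ := fun ij ↦ m ij.1 ij.2 with hwx
  have hwx_end : ∀ σ : ℂ ≃+* ℂ, toEnd (⇑σ ∘ wx) = Matrix.toLin B B (m.map σ) := fun σ ↦ rfl
  have hnat : ∀ (τ : ℂ →+* ℂ) (φ : A ⟶ A) (c : complexBetti A.X 1),
      coeffClass (R := ℂ) (S := ℂ) τ.toAddMonoidHom 1 (pullbackOne A φ c) =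
        pullbackOne A φ (coeffClass (R := ℂ) (S := ℂ) τ.toAddMonoidHom 1 c) := fun τ φ c ↦
    coeffClass_map (R := ℂ) (S := ℂ) τ.toAddMonoidHom (Motives.AlgPoints.mapContinuous (L := ℂ) φ.hom.hom.hom) c
  have hwxS : wx ∈ S := by
    rw [hS_mem]
    intro σ
    refine ⟨fun pq c hc ↦ ?_, fun φ c ↦ ?_⟩
    · rw [hwx_end, hconj]
      simpa only [RingEquiv.symm_symm] using
        Deligne1982.coeffClass_conj_mem_typePiece_of_commute_hodgeGroup M hX x hx σ.symm hc
    · rw [hwx_end, hconj, hconj, hnat, hx', hnat]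
  -- (5) Galois descent over `ℂ`: `S` is spanned by its rational matrices
  set F : Subfield ℂ := (Rat.castHom ℂ).fieldRange with hF
  have hFcount : Cardinal.mk F ≤ Cardinal.aleph0 := by
    rw [Cardinal.mk_le_aleph0_iff, hF]
    exact (Set.countable_range (Rat.castHom ℂ)).to_subtype
  have hdesc := Complex.submodule_le_span_fixed_of_forall_ringEquiv F hFcount S
    (fun ρ _ w hw ↦ hS ρ w hw) hwxS
  -- (6) `x = toEnd wx`, and `toEnd` of a rational matrix of `S` is a central pull-back up to a scalar
  have hx_eq : x = toEnd wx := by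
    rw [htoEnd]
    conv_lhs => rw [← Matrix.toLin_toMatrix B B x]
    rfl
  rw [hx_eq]
  have hmap := Submodule.mem_map_of_mem (f := toEnd) hdesc
  rw [Submodule.map_span] at hmap
  refine (Submodule.span_le.2 ?_) hmap
  rintro _ ⟨w, ⟨hwS, hwF⟩, rfl⟩
  -- the rational matrix `q` with `↑q = w`
  have hq : ∀ ij, ∃ q : ℚ, (q : ℂ) = w ij := fun ij ↦ by
    obtain ⟨q, hq⟩ := RingHom.mem_fieldRange.1 (hF ▸ hwF ij)
    exact ⟨q, hq⟩
  choose q hq using hq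
  let ψ : bettiCohomology A.X 1 →ₗ[ℚ] bettiCohomology A.X 1 := Matrix.toLin b b (Matrix.of fun i j ↦ q (i, j))
  have hψw : toEnd w = β.toLinearMap ∘ₗ ψ.baseChange ℂ ∘ₗ β.symm.toLinearMap := by
    refine B.ext fun j ↦ ?_
    rw [htoEnd, Matrix.toLin_self]
    have hβB : β.symm (B j) = (1 : ℂ) ⊗ₜ b j := by
      rw [← hBc]
      exact β.symm_apply_eq.2 (Module.Basis.map_apply _ _ _)
    rw [LinearMap.comp_apply, LinearMap.comp_apply, LinearEquiv.coe_toLinearMap,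
      LinearEquiv.coe_toLinearMap, hβB, LinearMap.baseChange_tmul, Matrix.toLin_self,
      TensorProduct.tmul_sum, map_sum]
    refine Finset.sum_congr rfl fun i _ ↦ ?_
    rw [Matrix.of_apply, Matrix.of_apply, ← TensorProduct.smul_tmul, Rat.smul_one_eq_cast, hβdef,
      ofRatClassBaseChangeEquiv_apply, ofRatClassBaseChange_tmul, hq, ← hB]
  have hPw : Pres (toEnd w) := (hS_mem w).1 hwS (RingEquiv.refl ℂ)
  -- `ψ` is a weight-one Hodge morphism, hence `n • ψ = u^*` by Riemann's theorem
  have hHM : IsHodgeMorphismOne A A ψ :=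
    Deligne1982.isHodgeMorphismOne_of_preserves_typePiece A M ψ (by rw [← hψw]; exact hPw.1)
  obtain ⟨u, n, hn, hu⟩ := deligneMilne1982_Thm_6_20_full_holds A A ψ ⟨M⟩ hHM
  have hψ' : (bettiCohomology.map u.hom.hom.hom 1).hom = (n : ℚ) • ψ := by
    refine LinearMap.ext fun v ↦ ?_
    rw [LinearMap.smul_apply, Nat.cast_smul_eq_nsmul]
    exact hu v
  have key : pullbackOne A u = (n : ℂ) • toEnd w := by
    rw [hψw]
    refine LinearMap.ext fun v ↦ ?_
    obtain ⟨t, rfl⟩ := β.surjective v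
    have e := complexBetti_map_ofRatClassBaseChangeEquiv hX hX u.hom.hom.hom (k := 1) t
    rw [← hβdef] at e
    change complexBetti.map u.hom.hom.hom 1 (β t) = _
    rw [e, hψ', LinearMap.baseChange_smul, LinearMap.smul_apply, LinearMap.smul_apply]
    simp only [LinearMap.comp_apply, LinearEquiv.coe_toLinearMap, LinearEquiv.symm_apply_apply]
    rw [← algebraMap_smul ℂ (n : ℚ), map_smul, map_natCast]
  have hn0 : (n : ℂ) ≠ 0 := Nat.cast_ne_zero.2 hn.ne'
  have hy : toEnd w = (n : ℂ)⁻¹ • pullbackOne A u := by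
    rw [key, smul_smul, inv_mul_cancel₀ hn0, one_smul]
  have huC : pullbackOne A u ∈ centralizerAlgebra A := by
    rw [mem_centralizerAlgebra_iff']
    intro φ c
    have h := hPw.2 φ c
    rw [hy, LinearMap.smul_apply, LinearMap.smul_apply, map_smul] at h
    exact smul_right_injective (complexBetti A.X 1) (inv_ne_zero hn0) h
  rw [hy]
  exact Submodule.smul_mem _ _ (Submodule.subset_span ⟨u, rfl, huC⟩)

/-! ### 1f. Central pull-backs are symmetric for the polarization form (Rosati = identity on a totally real centre) -/

/-- The adjoint of a real endomorphism for a real form is real. [folklore] -/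
private theorem isReal_of_isAdj {B : LinearMap.BilinForm ℂ (complexBetti A.X 1)} (hBnd : B.Nondegenerate)
    (hBcj : ∀ x y, B (conjClass (ComplexPoints A.X) 1 x) (conjClass (ComplexPoints A.X) 1 y) =
      starRingEnd ℂ (B x y))
    {T T' : Module.End ℂ (complexBetti A.X 1)} (hadj : ∀ x y, B (T' x) y = B x (T y))
    (hT : ∀ x, conjClass (ComplexPoints A.X) 1 (T x) = T (conjClass (ComplexPoints A.X) 1 x)) :
    ∀ x, conjClass (ComplexPoints A.X) 1 (T' x) = T' (conjClass (ComplexPoints A.X) 1 x) := by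
  intro x
  refine eq_of_forall_left hBnd fun y ↦ ?_
  obtain ⟨y', rfl⟩ : ∃ y', y = conjClass (ComplexPoints A.X) 1 y' :=
    ⟨conjClass (ComplexPoints A.X) 1 y, (conjClass_conjClass y).symm⟩
  rw [hBcj, hadj, hadj, ← hT, hBcj]

/-- **The Rosati involution is the identity on central endomorphisms when `A` has no factor of type IV**
(Moonen–Zarhin: the centre of `End⁰(A)` is then a product of totally real fields, on which the positive
involution `†` of a polarization is trivial), on the carriers: for `u ∈ End(A)` with
`u^* ∈ C(A) ⊗ ℂ`, the pull-back `Y = u^*` is SELF-ADJOINT for the polarization form `B = Q_h`: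
`B(Yx, y) = B(x, Yy)`. Proof: the adjoint `Y'` of `Y` commutes with the Hodge group (which preserves
`B`), so lies in `End⁰(A) ⊗ ℂ` (Deligne's commutant theorem) and commutes with `Y`; `Y`, `Y'` are real
and type-preserving, and `Y` has real eigenvalues (`conj_eigenvalue_pullbackOne`); the linear algebra
`HodgeGroupSemisimple.eq_of_isAdj_of_comm` (positivity of `B(x, x̄)` on `H^{1,0}`) gives `Y' = Y`.
[cite: MoonenZarhin1999LowDim, §1 (Hg(X) ⊂ Sp_D(V, φ))] [cite: Deligne1982HodgeCycles, I §3, Prop. 3.4 and its proof]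
[cite: LangeBirkenhake1992, §5.1 (Rosati involution: adjoint for the Riemann form, positive)] -/
theorem isAdj_self_pullbackOne {B : LinearMap.BilinForm ℂ (complexBetti A.X 1)}
    (hBalt : ∀ x y, B y x = -B x y) (hBnd : B.Nondegenerate)
    (hBcj : ∀ x y, B (conjClass (ComplexPoints A.X) 1 x) (conjClass (ComplexPoints A.X) 1 y) =
      starRingEnd ℂ (B x y))
    (hpos : ∀ x ∈ hodgeOneZero (AbelianVariety.isSmoothProjective_holds (A := A)), x ≠ 0 →
      B x (conjClass (ComplexPoints A.X) 1 x) ≠ 0)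
    (hBinv : ∀ w ∈ hodgeGroupOne A.dim A.X, ∀ x y : complexBetti A.X 1, B (w x) (w y) = B x y)
    (hA4 : HasNoTypeIVFactor A) (u : A ⟶ A) (huC : pullbackOne A u ∈ centralizerAlgebra A) :
    ∀ x y, B (pullbackOne A u x) y = B x (pullbackOne A u y) := by
  have hX : IsSmoothProjective A.dim A.X := AbelianVariety.isSmoothProjective_holds
  haveI : FiniteDimensional ℂ (complexBetti A.X 1) := finite_complexBetti_abelianVariety A 1
  set Y := pullbackOne A u with hYdef
  obtain ⟨Y', hadj⟩ := exists_isAdj hBnd Y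
  have hYg : ∀ g ∈ hodgeGroup A.dim A.X, ∀ y : complexBetti A.X 1, Y (g 1 y) = g 1 (Y y) :=
    pullbackOne_commute_hodgeGroup u
  -- `Y'` commutes with the Hodge group on `H¹`
  have hY'G : ∀ w ∈ hodgeGroupOne A.dim A.X,
      Y' * (w : Module.End ℂ (complexBetti A.X 1)) = (w : Module.End ℂ (complexBetti A.X 1)) * Y' := by
    intro w hw
    have hwY : Y * (w.symm : Module.End ℂ (complexBetti A.X 1)) =
        (w.symm : Module.End ℂ (complexBetti A.X 1)) * Y := by
      refine LinearMap.ext fun v ↦ ?_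
      show Y (w.symm v) = w.symm (Y v)
      rw [eq_comm, LinearEquiv.symm_apply_eq]
      have h := hodgeGroupOne_comm_pullbackOne hw u (w.symm v)
      rw [LinearEquiv.apply_symm_apply] at h
      exact h.symm
    exact isAdj_mul_comm_of_mul_comm hBnd hadj (isAdj_symm_of_isometry (hBinv w hw)) hwY
  have hY'g : ∀ g ∈ hodgeGroup A.dim A.X, ∀ y : complexBetti A.X 1, Y' (g 1 y) = g 1 (Y' y) := by
    intro g hg y
    have h := LinearMap.congr_fun (hY'G (g 1) (mem_hodgeGroupOne_iff.2 ⟨g, hg, rfl⟩)) y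
    rw [Module.End.mul_apply, Module.End.mul_apply] at h
    exact h
  -- `Y' ∈ End⁰(A) ⊗ ℂ` and `Y ∈ C(A) ⊗ ℂ`, so they commute
  have hY'R : Y' ∈ Submodule.span ℂ (Set.range fun φ : A ⟶ A ↦ pullbackOne A φ) :=
    Deligne1982.mem_span_complexBetti_map_of_commute_hodgeGroup A Y' hY'g
  have hYc : Y ∈ Subalgebra.centralizer ℂ
      (Submodule.span ℂ (Set.range fun φ : A ⟶ A ↦ pullbackOne A φ) : Set (Module.End ℂ (complexBetti A.X 1))) := by
    rw [← centralizerAlgebra_eq_centralizer_span]; exact huC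
  have hcomm : Y * Y' = Y' * Y := (((Subalgebra.mem_centralizer_iff ℂ).1 hYc) Y' hY'R).symm
  -- reality and types
  have hYre : ∀ x, conjClass (ComplexPoints A.X) 1 (Y x) = Y (conjClass (ComplexPoints A.X) 1 x) := fun x ↦
    conjClass_map (Motives.AlgPoints.mapContinuous (L := ℂ) u.hom.hom.hom) x
  have hY're := isReal_of_isAdj hBnd hBcj hadj hYre
  have htY := preservesType_of_commute_hodgeGroup Y hYg
  have htY' := preservesType_of_commute_hodgeGroup Y' hY'g
  -- real eigenvalues
  have hroots : ∀ (μ : ℂ) (v : complexBetti A.X 1), v ≠ 0 → Y v = μ • v → starRingEnd ℂ μ = μ :=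
    fun μ v hv hμ ↦ conj_eigenvalue_pullbackOne hA4 u huC hv hμ
  have hYY' : Y' = Y :=
    eq_of_isAdj_of_comm hBalt (fun x y ↦ conjClass_add x y) (fun a x ↦ conjClass_smul a x)
      (fun x ↦ conjClass_conjClass x) (isCompl_hodgeOneZero_hodgeZeroOne hX)
      (fun x hx ↦ conjClass_mem_hodgeOneZero hX hx) hpos hBnd hadj hcomm hYre hY're htY htY' hroots
  intro x y
  have h := hadj x y
  rw [hYY'] at h
  exact h

/-! ## Part 2. The centre of `Hg(A)(ℂ)|_{H¹}` consists of involutions and is finite -/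

/-- **The centre of `Hg(A)(ℂ)|_{H¹}` is an elementary abelian `2`-group when `A` has no factor of type
IV** — the carrier form of Moonen–Zarhin's "`Z(Hdg) ⊂ U_E = {a ∈ (E ⊗ R)^* | a a† = 1}`" with `†`
trivial on the totally real centre `E`: a central `z` lies in the `ℂ`-span of the central pull-backs
(`mem_span_pullbackOne_of_commute`), hence is `B`-symmetric (`isAdj_self_pullbackOne`), and preserves
`B`; so `B(x, y) = B(zx, zy) = B(x, z²y)` and `z² = 1` by non-degeneracy of `Q_h` (hard Lefschetz,
`Milne1999.eq_zero_of_forall_polarizationPairingOne_eq_zero_of_hasHardLefschetzProperty`).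
[cite: MoonenZarhin1998WeilClasses, §1 Lemma (1) and "Z(Hdg) ⊂ U_E"] [cite: MoonenZarhin1999LowDim, §1] -/
theorem mul_self_eq_one_of_mem_center (h1 : 1 ≤ A.dim) (hA4 : HasNoTypeIVFactor A)
    {z : hodgeGroupOne A.dim A.X} (hz : z ∈ Subgroup.center (hodgeGroupOne A.dim A.X)) : z * z = 1 := by
  have hX : IsSmoothProjective A.dim A.X := AbelianVariety.isSmoothProjective_holds
  haveI : FiniteDimensional ℂ (complexBetti A.X 1) := finite_complexBetti_abelianVariety A 1
  obtain ⟨h, hQ, h11, hHL, hposQ⟩ := exists_polarizationClass (A := A) h1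
  obtain ⟨coord, hci, hcconj⟩ := exists_coord (A := A) h1
  set Q := polarizationPairingOne A.X h (A.dim - 1) with hQdef
  set B : LinearMap.BilinForm ℂ (complexBetti A.X 1) := Q.compr₂ coord with hBdef
  have hBapply : ∀ x y, B x y = coord (Q x y) := fun x y ↦ rfl
  have hc0 : ∀ w, coord w = 0 → w = 0 := fun w hw ↦ hci (by rw [hw, map_zero])
  have hBalt : ∀ x y, B y x = -B x y := fun x y ↦ by
    rw [hBapply, hBapply, hQdef, polarizationPairingOne_swap, map_neg]
  have hBnd : B.Nondegenerate := by
    refine ⟨fun x hx ↦ ?_, fun y hy ↦ ?_⟩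
    · exact Milne1999.eq_zero_of_forall_polarizationPairingOne_eq_zero_of_hasHardLefschetzProperty h1 hHL
        fun y ↦ hc0 _ (hx y)
    · refine Milne1999.eq_zero_of_forall_polarizationPairingOne_eq_zero_of_hasHardLefschetzProperty h1 hHL
        fun x ↦ ?_
      have e := hc0 _ (hy x)
      rw [hQdef] at e
      rw [polarizationPairingOne_swap, e, neg_zero]
  have hBcj : ∀ x y, B (conjClass (ComplexPoints A.X) 1 x) (conjClass (ComplexPoints A.X) 1 y) =
      starRingEnd ℂ (B x y) := fun x y ↦ by
    rw [hBapply, hBapply, hQdef, ← conjClass_polarizationPairingOne hQ, hcconj]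
  have hpos : ∀ x ∈ hodgeOneZero hX, x ≠ 0 → B x (conjClass (ComplexPoints A.X) 1 x) ≠ 0 :=
    fun x hx hx0 h0 ↦ hposQ x hx hx0 (hc0 _ h0)
  have hBinv : ∀ w ∈ hodgeGroupOne A.dim A.X, ∀ x y : complexBetti A.X 1, B (w x) (w y) = B x y := by
    intro w hw x y
    rw [hBapply, hBapply, hQdef,
      (Milne1999.hodgeGroupOne_le_unitaryCentralizerGroup_of_isRationalClass hQ h11 hw).2 x y]
  -- the central element as an endomorphism `T`
  obtain ⟨T, hT⟩ : ∃ T : Module.End ℂ (complexBetti A.X 1), ∀ y,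
      T y = ((z : hodgeGroupOne A.dim A.X) : complexBetti A.X 1 ≃ₗ[ℂ] complexBetti A.X 1) y :=
    ⟨((z : hodgeGroupOne A.dim A.X) : complexBetti A.X 1 ≃ₗ[ℂ] complexBetti A.X 1), fun _ ↦ rfl⟩
  have hTg : ∀ g ∈ hodgeGroup A.dim A.X, ∀ y : complexBetti A.X 1, T (g 1 y) = g 1 (T y) := by
    intro g hg y
    have hg1 : g 1 ∈ hodgeGroupOne A.dim A.X := mem_hodgeGroupOne_iff.2 ⟨g, hg, rfl⟩
    have hzg := Subgroup.mem_center_iff.1 hz ⟨g 1, hg1⟩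
    have e := LinearEquiv.congr_fun (congrArg Subtype.val hzg) y
    change (g 1 * ((z : hodgeGroupOne A.dim A.X) : complexBetti A.X 1 ≃ₗ[ℂ] complexBetti A.X 1)) y =
      (((z : hodgeGroupOne A.dim A.X) : complexBetti A.X 1 ≃ₗ[ℂ] complexBetti A.X 1) * g 1) y at e
    rw [LinearEquiv.mul_apply, LinearEquiv.mul_apply] at e
    rw [hT, hT]
    exact e.symm
  have hTφ : ∀ (φ : A ⟶ A) (y : complexBetti A.X 1), T (pullbackOne A φ y) = pullbackOne A φ (T y) := by
    intro φ y
    rw [hT, hT]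
    exact mem_centralizerGroup_iff.1 (hodgeGroupOne_le_centralizerGroup z.2) φ y
  -- every element of the span of the central pull-backs is `B`-symmetric, in particular `T`
  have key : ∀ S ∈ Submodule.span ℂ {Y : Module.End ℂ (complexBetti A.X 1) |
      ∃ u : A ⟶ A, Y = pullbackOne A u ∧ pullbackOne A u ∈ centralizerAlgebra A},
      ∀ x y, B (S x) y = B x (S y) := by
    intro S hS
    induction hS using Submodule.span_induction with
    | mem S hS =>
      obtain ⟨u, rfl, huC⟩ := hS
      exact isAdj_self_pullbackOne hBalt hBnd hBcj hpos hBinv hA4 u huC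
    | zero =>
      intro x y
      simp only [LinearMap.zero_apply, map_zero]
    | add S S' _ _ hS hS' =>
      intro x y
      simp only [LinearMap.add_apply, map_add, hS, hS']
    | smul a S _ hS =>
      intro x y
      simp only [LinearMap.smul_apply, map_smul, hS]
  have hsymm : ∀ x y, B (T x) y = B x (T y) := key T (mem_span_pullbackOne_of_commute A T hTg hTφ)
  -- `z² = 1`
  have hzz : ∀ y, ((z : hodgeGroupOne A.dim A.X) : complexBetti A.X 1 ≃ₗ[ℂ] complexBetti A.X 1)
      (((z : hodgeGroupOne A.dim A.X) : complexBetti A.X 1 ≃ₗ[ℂ] complexBetti A.X 1) y) = y := fun y ↦ by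
    refine eq_of_forall_right hBnd fun x ↦ ?_
    calc B x (((z : hodgeGroupOne A.dim A.X) : complexBetti A.X 1 ≃ₗ[ℂ] complexBetti A.X 1)
          (((z : hodgeGroupOne A.dim A.X) : complexBetti A.X 1 ≃ₗ[ℂ] complexBetti A.X 1) y))
        = B x (T (T y)) := by rw [hT, hT]
      _ = B (T x) (T y) := (hsymm x (T y)).symm
      _ = B (((z : hodgeGroupOne A.dim A.X) : complexBetti A.X 1 ≃ₗ[ℂ] complexBetti A.X 1) x)
          (((z : hodgeGroupOne A.dim A.X) : complexBetti A.X 1 ≃ₗ[ℂ] complexBetti A.X 1) y) := by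
        rw [hT, hT]
      _ = B x y := hBinv _ z.2 x y
  apply Subtype.ext
  rw [Subgroup.coe_mul, Subgroup.coe_one]
  exact LinearEquiv.ext fun y ↦ by rw [LinearEquiv.mul_apply]; exact hzz y

/-- **The centre of `Hg(A)(ℂ)|_{H¹}` is finite when `A` has no factor of type IV** (`dim A ≥ 1`): a
commutative group of involutions of `H¹(A(ℂ); ℂ)` is finite (`finite_of_comm_of_mul_self_eq_one`).
[cite: MoonenZarhin1998WeilClasses, §1 Lemma (1)] [cite: MoonenZarhin1999LowDim, §1] -/
theorem finite_center_hodgeGroupOne (h1 : 1 ≤ A.dim) (hA4 : HasNoTypeIVFactor A) :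
    Finite (Subgroup.center (hodgeGroupOne A.dim A.X)) := by
  haveI : FiniteDimensional ℂ (complexBetti A.X 1) := finite_complexBetti_abelianVariety A 1
  let C : Subgroup (complexBetti A.X 1 ≃ₗ[ℂ] complexBetti A.X 1) :=
    (Subgroup.center (hodgeGroupOne A.dim A.X)).map (hodgeGroupOne A.dim A.X).subtype
  have hC : Finite C := by
    refine finite_of_comm_of_mul_self_eq_one C (fun a ha b hb ↦ ?_) (fun a ha ↦ ?_)
    · obtain ⟨za, hza, rfl⟩ := Subgroup.mem_map.1 ha
      obtain ⟨zb, hzb, rfl⟩ := Subgroup.mem_map.1 hb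
      have h := Subgroup.mem_center_iff.1 hza zb
      change (za : complexBetti A.X 1 ≃ₗ[ℂ] complexBetti A.X 1) * zb = zb * za
      rw [← Subgroup.coe_mul, ← Subgroup.coe_mul, h]
    · obtain ⟨za, hza, rfl⟩ := Subgroup.mem_map.1 ha
      have h := mul_self_eq_one_of_mem_center h1 hA4 hza
      change (za : complexBetti A.X 1 ≃ₗ[ℂ] complexBetti A.X 1) * za = 1
      rw [← Subgroup.coe_mul, h, Subgroup.coe_one]
  refine Finite.of_injective (fun z : Subgroup.center (hodgeGroupOne A.dim A.X) ↦
    (⟨((z : hodgeGroupOne A.dim A.X) : complexBetti A.X 1 ≃ₗ[ℂ] complexBetti A.X 1),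
      Subgroup.mem_map.2 ⟨z.1, z.2, rfl⟩⟩ : C)) fun z₁ z₂ hzz ↦ ?_
  simp only [Subtype.mk.injEq] at hzz
  exact Subtype.ext (Subtype.ext hzz)

end HodgeGroupSemisimple

/-! ## Part 3. The named fact, discharged -/

open HodgeGroupSemisimple in
/-- **Moonen–Zarhin 1999, §1 ("If `X` has no factors of Type 4 then `Hg(X)` is semi-simple"), PROVED on
the carriers: the tree's named fact `MoonenZarhin1999_semisimple_of_hasNoTypeIVFactor`.** For a complex
abelian variety `A` all of whose central endomorphisms have totally real minimal polynomials
(`HasNoTypeIVFactor A`), the centre of the Tannaka-free Hodge group `Hg(A)(ℂ) ≤ ∏ₖ GL(Hᵏ(A(ℂ); ℂ))` is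
finite (`HasSemisimpleHodgeGroup A`). Printed argument (Moonen–Zarhin 1999 §1: `Hg(X) ⊂ Sp_D(V, φ)`;
Moonen–Zarhin 1998 §1:
"the center `Z(Hdg)` of the Hodge group is contained in the torus `U_E`",
`U_{K}(R) = {a ∈ (K ⊗ R)^* | a a† = 1}`, "a connected torus [for] type 4 …; in all other cases it is
finite"), here: a central `z ∈ Hg(A)(ℂ)|_{H¹}` commutes with `Hg` and with `End(A)`, so lies in
`Z(End⁰(A)) ⊗ ℂ` read on `H¹` (Deligne I 3.4/5.1 + Riemann, with Galois descent); for `Z(End⁰ A)` totally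
real the Rosati involution of a polarization `Q_h` is trivial on it (positivity of `Q_h(x, x̄)` on
`H^{1,0}`), so `z` is `Q_h`-symmetric as well as `Q_h`-orthogonal: `z² = 1`; a commutative group of
involutions of `H¹` is finite, and `Hg(A)(ℂ) ≅ Hg(A)(ℂ)|_{H¹}` (`VanGeemen1994.finite_center_hodgeGroup_of_hodgeGroupOne`).
[cite: MoonenZarhin1999LowDim, §1] [cite: MoonenZarhin1998WeilClasses, §1 (second Remark after the Criterion; Lemma (1); "Z(Hdg) ⊂ U_E")]
[cite: Deligne1982HodgeCycles, I §3, Prop. 3.4 and its proof] -/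
theorem MoonenZarhin1999_semisimple_of_hasNoTypeIVFactor_holds :
    MoonenZarhin1999_semisimple_of_hasNoTypeIVFactor := by
  intro A hA4
  by_cases h0 : A.dim = 0
  · -- `H¹ = 0`: the general linear group of `H¹` is trivial
    haveI : FiniteDimensional ℂ (complexBetti A.X 1) := finite_complexBetti_abelianVariety A 1
    haveI : Subsingleton (complexBetti A.X 1) := by
      rw [← Module.finrank_zero_iff (R := ℂ), Motives.AbelianVariety.finrank_complexBetti_one, h0]
    haveI : Subsingleton (complexBetti A.X 1 ≃ₗ[ℂ] complexBetti A.X 1) :=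
      ⟨fun e e' ↦ LinearEquiv.ext fun v ↦ Subsingleton.elim _ _⟩
    have hfin : Finite (hodgeGroupOne A.dim A.X) :=
      Finite.of_injective (fun g : hodgeGroupOne A.dim A.X ↦ (g : complexBetti A.X 1 ≃ₗ[ℂ] complexBetti A.X 1))
        Subtype.val_injective
    haveI := hfin
    exact VanGeemen1994.finite_center_hodgeGroup_of_hodgeGroupOne A
      (Finite.of_injective (fun z : Subgroup.center (hodgeGroupOne A.dim A.X) ↦ (z : hodgeGroupOne A.dim A.X))
        Subtype.val_injective)
  · exact VanGeemen1994.finite_center_hodgeGroup_of_hodgeGroupOne A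
      (finite_center_hodgeGroupOne (Nat.one_le_iff_ne_zero.2 h0) hA4)

/-- **Lombardo's Lemma 3.4 (span form) from Gordon's splitting fact alone.** With Moonen–Zarhin's
"no factor of type IV ⟹ `Hg` semisimple" now a theorem
(`MoonenZarhin1999_semisimple_of_hasNoTypeIVFactor_holds`), Part I's named fact
`Lombardo2016_hodgeClassesProductSpan` ("`A` without type-IV factors, `C` of CM type ⟹ the rational
Hodge classes of `A × C` are spanned by exterior products") follows from Gordon's splitting fact
`Gordon1999_hodgeClassesProductSpan_of_semisimple` alone — one binder instead of the two of
`lombardo2016_of_gordon_of_moonenZarhin`. [cite: Lombardo2016, Lemma 3.4 (p. 1229)]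
[cite: MoonenZarhin1999LowDim, §1 and §3 (3.1)] -/
theorem lombardo2016_of_gordon (hG : Gordon1999_hodgeClassesProductSpan_of_semisimple) :
    Lombardo2016_hodgeClassesProductSpan :=
  lombardo2016_of_gordon_of_moonenZarhin hG MoonenZarhin1999_semisimple_of_hasNoTypeIVFactor_holds

end Literature.AlgebraicGeometry.HodgeTheory

end
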